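import Literature.MathematicalPhysics.QuantumFieldTheory.Balaban1983to89.B9Thm32CinvAtMemberOfCubeDataThmD
import Literature.MathematicalPhysics.QuantumFieldTheory.Balaban1983to89.B9Eq335CubeDomCoverWideP
import Literature.MathematicalPhysics.QuantumFieldTheory.Balaban1983to89.B9Thm39OneCubeReadingAtLettersY
import Literature.MathematicalPhysics.QuantumFieldTheory.Balaban1983to89.Node00.OpsYRecordV4P
import Literature.MathematicalPhysics.QuantumFieldTheory.Balaban1983to89.B9Cor36CubeCutoffs
import Literature.MathematicalPhysics.QuantumFieldTheory.Balaban1983to89.B9Thm311PosAtRecordV4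

/-!
# `Balaban1983to89.B9Conv348OfRegYP335AtLettersY` — T. Bałaban, *Propagators for lattice gauge theories in a background field*, Commun. Math. Phys. **99**
# (1985) 389–434 [Balaban1985BackgroundPropagators], THEOREM 3.2 (3.48) p. 398 read on the inverse ((3.96) p. 411): ROWS 15–16's ONE DISPLAY `h348` OF THE
# N06 KNIT — `Conv348Blk (oneCubeOps39YF θ M⋆ (lettersYOfRecordV4P …) bI x) B δ U` — DERIVED ON PRINT's CLASS (3.35) at def-Y's letters of record, for every
# SECTION-CARRYING member above one threshold, from lit-balaban's LANDED member-level Theorem 3.2 (`B9Thm32CinvAtMemberOfCubeDataThmD`) fed the P-class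
# cube datum (cell `pub-ymgap`, seat `dag-n06-j` gen 31, bundle F5 rows 15–16)

[4] = T. Bałaban, *Propagators and renormalization transformations for lattice gauge theories. II*, Commun. Math. Phys. **96** (1984) 223–250
[`Balaban1984PropagatorsII`].

statement-level skeleton of published theorems with citation tags; proofs where landed; nothing here is a claim about the Yang–Mills mass gap

THE PRINT (held `paper:balaban1985-cmp99-background-propagators`, journal page = PDF page + 388).  Thm 3.2 p. 398: *«|(Q′(U)G′²(U)Q′\*(U))⁻¹(y, y′)| ≦
B₀(Lʲη)⁻⁴(L^{j′}η)^{−d}e^{−δ₀d(y,y′)}, y, y′ ∈ 𝔅»* (3.48); p. 411 (3.96): *«(Q′G′²Q′\*)⁻¹ = C₀(I − R)⁻¹ = Σ C₀Rⁿ»*; p. 413 Thm 3.9: *«For M sufficiently large,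
and a configuration U satisfying (3.35) … This theorem implies Theorem 3.2»*; p. 396 (3.35) (the cube class, «a number ≧ 10», «for an arbitrary cube □ of the
described above class … there exists a gauge transformation u on □ such that U^u = e^{iηA} …»); p. 409: *«the cube □̃⁵ is contained in one of the cubes for which
this condition holds»*; [4] (2.2) p. 224 (the collar axiom), (2.51) p. 232 (block majorants), (2.86)–(2.87) p. 238.

WHY THIS FILE (cell context).  The N06 certificate of record (dag-n06-d ED.76 `Thm/BalabanUVNodesN06AtOpsYNuOfRecordV6EPairUB`, l. 103) DISPLAYS rows 15–16's
analytic input WHOLE: `h348 : ∀ x, M₃₉ ≤ M → ∀ α₀ > 0, c·M·α₀ ≤ a₃₉ → ∀ U, (bg9YR … R₁ R₂ x).Reg335 c α₀ U → Conv348Blk (oneCubeOps39YF θ M⋆ (lettersYOfRecordV4P …)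
bI x) B₃₉ δ₃₉ U` — Theorem 3.2 (3.48) for the GLOBAL `(Q′G′²Q′\*)⁻¹(U)` in print's units and real coordinates (n06-j g5∕g14 letters `L39`, `blk39F`).  The
lineage reached this display at `U = 1` (g14 `B9Conv348AtOneLettersY`) and on the pure-gauge orbit (g15 `B9Conv348GaugeOrbitAtLettersY`).  Meanwhile cell
`lit-balaban` (seats p21∕p33, sub-row G-B9-LETTERS, modules M5.1b–M5.6 + «Theorem D») LANDED Theorem 3.2 proper at the member letter `parSymY`:
`B9Thm32CinvAtMemberOfCubeDataThmD.cinv_at_member_of_cubeData_thmD` (p652125; axioms ⊆ {propext, Classical.choice, Quot.sound}) — `conj b((η²η²)⁻¹•(Q′G′²Q′\*)⁻¹(U))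
≺ K·ℓ(a)⁻⁴·e^{−δd}` on the block carrier `(t, j) ↦ ιB t` for every member above ONE threshold with `c_f = L^k`, every `G`-valued `U` (`G ≤ U(N)`) and EVERY
FAMILY OF PER-CUBE (3.35) DATA (bi-contractive gauges `u_□`, potentials `A_□` on torus sets `Q_□ ⊇ NearC_□(35S_j∕8 + 1)`, …) — p33's question (Q1) «which class
cube supplies `Q_□`» left to the consumer.  THIS FILE IS THE N06 CONSUMER: (i) (Q1) is answered at def-Y's members by the family axiom `hR2 : 2L² ≤ R` — the aligned
cube of `2L` big `j`-blocks cornered at `(β − ℓ)·S_j` is a P-triple of index `j` or `j − 1` (g23 `B9Eq335CubeDomCoverWideP.alignedCube_mem_cubeClassP_or`) and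
CONTAINS the ball `NearC_□(35S_j∕8 + 1)` (§3), so `U ∈ (bg9YP … x).Reg335 c₃₅ α₀` supplies the datum on every ball at scale `Lʲη` with constant `2L⁴·Mα₀`
(g23 `reg335Cube_of_wideCover_or`, p33 `exists_cubeData_of_reg335Cubes`); (ii) the letter dictionary `realify39 = conj ∘ (·)|_ℝ`, `unit39 = η⁴` (`MemberY.hcfk`),
`(lettersYOfRecordV4P …).parS ∕ .Gp = parSymY ∕ GpY parSymY` (rfl), `blk39F bI = rep39F bI ∘ fst` (rfl), `T·L39 = L39·T = 1` (Thm 3.11, n06-j `isUnit_XY_parSymY`).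

THE HONEST LIMIT (located with it).  lit-balaban's member packages carry the SECTION binder `hι : ∀ s, β (ιB s) = s` — inhabitable iff the member's
carrier-block map `β` is onto `𝔅`, i.e. iff the family `{Ω_j}` has NO INNER CORNER (dag-n06-i `B9BetaRangeKLevelV1.surjective_beta_iff`; [4]'s axioms
(2.1)–(2.2) allow both).  With `β` onto, the faithful representative `rep39F bI` of the knit's bond map IS a section (`beta_rep39F_beta`), so rows 15–16 follow;
at inner-corner members they STAY DISPLAYED (a faithful-map variant of `hι` upstream — `lvl (ιB t) = lvl t`, `d_T(β(ιB t), t) ≤ 1`, n06-k `exists_faithful_kIdx`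
— would reach every member).  Every constant-level member (`TDomains.top`) is section-carrying.

WHAT IS PROVED (sorry-free; 0 `def`; nothing of [B9] asserted beyond what is proved).
* §1 `realify39_eq_conj` (`realify39 b O = conj b (O|_ℝ)`), `realify39_real_smul_eq_conj`, `unit39_eq_etaS_sq_mul` (`unit39 = η_S²·η_S²` at a member).
* §2 ★ `invL39_two_sided_of_mem` (`T·L39(U) = 1 = L39(U)·T` for `T = realify39 basis39 (unit39⁻¹ • (Q′G′²Q′\*)⁻¹(U))`, `U` `G`-valued, `G ≤ U(N)`).
* §3 `nearC_window_arith`, `sixteen_le_bigSide`, ★★ `exists_cubeClassP_nearC` (THE BALL `NearC_□(35S_j∕8 + 1)` LIES IN ONE CUBE OF PRINT's CLASS — p33's (Q1) at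
  def-Y's members), ★★ `reg335Cube_nearC_of_reg335P` ((3.35) on the ball: ONE gauge, ONE small field, scale `Lʲη`, constant `2L⁴·Mα₀`).
* §4 ★★★ **`conv348_oneCubeYF_of_regYP335_section`** — `∃ M₁ a₁ B₀ δ₀ > 0, ∀ 𝔯 bI (hβI) x, Surjective β → M₁ ≤ M → ∀ α₀ > 0, c₃₅·M·α₀ ≤ a₁ → ∀ U,
  (bg9YP 𝕄 SU(N) x).Reg335 c₃₅ α₀ U → Conv348Blk (oneCubeOps39YF θ M⋆ (lettersYOfRecordV4P N θ M⋆ 𝔯) bI x) B₀ δ₀ U` (`N ≥ 1`);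
  ★★★ **`conv348_oneCubeYF_of_regYR_section`** — the same at the certificate's R-generic premise (`(bg9YR … R₁ R₂ x).Reg335 c α₀ U`, guard `c·M·α₀ ≤ a₁`,
  `0 < c`) through the knit's displayed class transfer `hRP1` (ED.76's binder shape VERBATIM).
MODEL ∕ DECLARED READINGS.  def-Y's letters of record (`lettersYOfRecordV4P`, `parSymY`, `GpY`, `XY`, `XinvY`), print's class `bg9YP … c35Y` (MODULE 2-P), the
one-cube reading `oneCubeOps39YF` ∕ `blk39F` (n06-j∕n06-i), lit-balaban's constants (existential `δ, K`, thresholds `M₀, T₀, N₀`, budget `a₁`; here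
`M₁ := max(M₀, N₀+1, T₀+1, 1)`, `a₁′ := c₃₅·min(a₁, ¼)∕(2L⁶(1+D₁θ))`, `B₀ := K + 1`, `δ₀ := δ`).  A6: the class is inhabited at every `α₀ > 0` (`U = 1`,
`B9BackgroundsKLevelV1P.reg335P_one`); section-carrying members exist (`TDomains.top`).
HONEST SCOPE.  COMPOSITION of landed theorems (lit-balaban M5.1b–M5.6 + Thm D chain, g23's cover, p33's unpacking, n06-j's Thm 3.11 letters); the estimates of
[B9] Sect. C live in the imported chain, nothing is newly asserted here; rows 15–16 become a THEOREM on the section-carrying sub-family ONLY — the certificate's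
display over ALL members is NOT discharged by this file; NOT a node discharge, NOT summit progress; count-neutral; finite 𝕋 members of the k-level V1 family;
nothing continuum ∕ OS ∕ mass gap ∕ Clay.  Cell `pub-ymgap` (HUMAN RULING D-0062), Track A node N06 [B9], seat `pub-ymgap-dag-n06-j` (harness re-seat gen 31),
2026-08-29.  No `sorry`, no `axiom`, no `instance`, no `notation`, no `def`.  NEW file; nothing landed is modified.
RELATED IN THE TREE, NOT DUPLICATED (searched 2026-08-29: `ls …/Balaban1983to89/ | grep Conv348OfRegYP335` = ∅, `lean search 'exists_cubeClassP_nearC|realify39_eq_conj'` = ∅):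
lit-balaban `B9Thm32CinvAtMemberOfCubeDataThmD` ∕ `B9Cor36GpCoverBindersUnitary` ∕ `B9Cor36CubeCutoffs` (USED BY NAME), g23 `B9Eq335CubeDomCoverWideP` (USED BY
NAME; its `exists_cubeClassP_cubeDomY_wideCollar` covers `□̃(c)` + a collar, here the concentric ball), g14∕g15 `B9Conv348AtOneLettersY` ∕ `B9Conv348GaugeOrbitAtLettersY`
(the display at `U = 1` ∕ on the pure-gauge orbit — sub-classes), lit-balaban t2s-1 `B9Eq335CubeDatumOfReg335Zd` (the same twelve clauses from a `ℤ^{d+1}` datum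
for the [B8] Thm 2 assembler — a different carrier and consumer).
-/

noncomputable section

namespace Literature.MathematicalPhysics.QuantumFieldTheory.Balaban1983to89.B9Conv348OfRegYP335AtLettersY

open Literature.MathematicalPhysics.QuantumFieldTheory.Balaban1983to89
open B6RandomWalk B9Thm39WholeBlk B9Thm39ReadingCoords B9Thm39ReadingAtLetters B9Thm39OneCubeReadingAtLettersY Node00
open B6KLevelCensusIndexV1 B6Ineq2142KLevelV1 B6GlobalChartV1 B9PinMembersKLevelV1 B9PinGeometryKLevelV1 B9GeoNormsKLevelV1
  B9BackgroundsKLevelV1 B9BackgroundsKLevelV1P B9Eq335CoverageWindow B9Eq335CubeDomCoverP B9Eq335CubeDomCoverWideP B9Thm34Ext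
open Literature.MathematicalPhysics.QuantumFieldTheory.Balaban1983to89.B6MultiLevelBoxOperator (bigSide N0)
open Literature.MathematicalPhysics.QuantumFieldTheory.Balaban1983to89.B6Cover236MultiLevelBlocks (cubes wit lev_wit blk_wit)
open Literature.MathematicalPhysics.QuantumFieldTheory.Balaban1983to89.B4TorusKernel.MultiPeriod (circAbs)
open Literature.MathematicalPhysics.QuantumFieldTheory.Balaban1983to89.B9Eq335RegularityClasses (Reg335Cube)
open Literature.MathematicalPhysics.QuantumFieldTheory.Balaban1983to89.LatticeNorms (scaleLen)
open Literature.MathematicalPhysics.QuantumFieldTheory.Balaban1983to89.B9Ineq349SiteFromConv348 (rep39F blk39F beta_rep39F_beta)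
open Literature.MathematicalPhysics.QuantumFieldTheory.Balaban1983to89.B9Eq352DivFormLetters (conj conj_apply coordEquiv)
open Literature.MathematicalPhysics.QuantumFieldTheory.Balaban1983to89.B9Cor36CubeCutoffs (NearC SC exists_gauge_fld_of_reg335Cube)
open Literature.MathematicalPhysics.QuantumFieldTheory.Balaban1983to89.B9CubeSequence408 (ctrC sI hf)
open Literature.MathematicalPhysics.QuantumFieldTheory.Balaban1983to89.B9Thm32CinvAtMemberOfCubeDataThmD (cinv_at_member_of_cubeData_thmD)
open Literature.MathematicalPhysics.QuantumFieldTheory.Balaban1983to89.B9Thm311PosAtRecordV4 (isUnit_XY_parSymY)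
open Literature.MathematicalPhysics.QuantumFieldTheory.Balaban1983to89.B4PartitionUnity22 (thetaProf D1 D1_nonneg contDiff_thetaProf hasCompactSupport_thetaProf)
open Literature.MathematicalPhysics.QuantumFieldTheory.Balaban1983to89.B9GeoLemma21KLevelV1 (geo9Y_len_pos)
open Literature.MathematicalPhysics.QuantumFieldTheory.Balaban1983to89.B9Eq39Adjoint (fluct covD)
open Literature.MathematicalPhysics.QuantumFieldTheory.Balaban1983to89.B9Eq360DeltaPrimeAY (AfldY)

/-! ## §1 The letter dictionary: `realify39 = conj ∘ restrictScalars`, `unit39 = η_S⁴` at a member -/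

section Dictionary

variable {𝔸 : Type} [NormedRing 𝔸] [NormedAlgebra ℂ 𝔸]
variable {S κ : Type} [Fintype κ]

/-- **n06-j's `realify39` IS lit-balaban's `conj` OF THE ℝ-RESTRICTED OPERATOR** (both are «coordinates ∘ O ∘ coordinates⁻¹» for the same real basis).
[cite: Balaban1984PropagatorsII, (2.51) p.232 (the real-coordinate carrier); Balaban1985BackgroundPropagators, p.389, dictionary] -/
theorem realify39_eq_conj (b : Module.Basis κ ℝ 𝔸) (O : (S → 𝔸) →ₗ[ℂ] (S → 𝔸)) :
    realify39 b O = conj b (O.restrictScalars ℝ) := by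
  apply LinearMap.ext; intro μ; funext p
  have e : coordEquiv39 b μ = (coordEquiv b).symm μ := by
    funext s; rw [coordEquiv39_apply, B9Eq352DivFormLetters.coordEquiv_symm_apply]
  rw [realify39_apply, coordEquiv39_symm_apply, conj_apply, LinearMap.restrictScalars_apply, e]

/-- a REAL scalar passes through the dictionary: `realify39 b ((r : ℂ) • O) = conj b (r • O|_ℝ)`. [cite: Balaban1985BackgroundPropagators, (3.48) p.398 (the unit factor), dictionary] -/
theorem realify39_real_smul_eq_conj (b : Module.Basis κ ℝ 𝔸) (r : ℝ) (O : (S → 𝔸) →ₗ[ℂ] (S → 𝔸)) :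
    realify39 b (((r : ℝ) : ℂ) • O) = conj b (r • O.restrictScalars ℝ) := by
  rw [realify39_eq_conj]
  congr 1

end Dictionary

section Units

variable {d ℓ : ℕ} {hd : 1 ≤ d + 1} {hL : Odd (ℓ + 1) ∧ 1 < ℓ + 1} {b₀ b₁ : ℝ} {Mstar : ℕ}

/-- **PRINT's UNIT FACTOR AT A MEMBER IS `η⁴`**: `unit39 = |c_f|^{d+1}·η^{4+(d+1)}` with the member's pin `c_f = L^k = η⁻¹` (`MemberY.hcfk`) equals
`η_S²·η_S²` — lit-balaban's scalar `(η²η²)` of `C = (Q′(η²G′)²Q′*)⁻¹`. [cite: Balaban1985BackgroundPropagators, (3.48) p.398 + (3.25) p.395 (units of `G′`), dictionary] -/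
theorem unit39_eq_etaS_sq_mul (x : MemberY d ℓ hd hL b₀ b₁ Mstar) : unit39 x.toKIdx = etaS x.toKIdx ^ 2 * etaS x.toKIdx ^ 2 := by
  have hk : (toKT x.toKIdx).k = x.k := rfl
  unfold unit39 etaS B6Prop22KLevelTorusCensusEta.nKT
  rw [x.hcfk, hk, abs_of_nonneg (by positivity)]
  push_cast
  have hL0 : (0:ℝ) < ((ℓ:ℝ) + 1) := by positivity
  have hp : (0:ℝ) < ((ℓ:ℝ) + 1) ^ x.k := by positivity
  field_simp
  ring

end Units

/-! ## §2 The two-sided inverse of `L39(U) = realify39 (unit39 • Q′G′²Q′*)(U)` at a `G`-valued `U`, `G ≤ U(N)` -/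

section Inverse

open scoped Matrix.Norms.L2Operator

variable {d ℓ : ℕ} {hd : 1 ≤ d + 1} {hL : Odd (ℓ + 1) ∧ 1 < ℓ + 1} {b₀ b₁ : ℝ}
variable {N : ℕ} {G : Subgroup (Matrix (Fin N) (Fin N) ℂ)ˣ}

/-- ★ **`L39(U)` HAS THE TWO-SIDED INVERSE `realify39 basis39 (unit39⁻¹ • (Q′G′²Q′*)⁻¹(U))`** at every `G`-valued `U`, `G ≤ U(N)` — Theorem 3.11's third
positivity (n06-j `isUnit_XY_parSymY`) read through the multiplicative dictionary. [cite: Balaban1985BackgroundPropagators, Thm 3.11 p.416 + (3.25) p.395 + (3.96) p.411] -/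
theorem invL39_two_sided_of_mem (i : KIdx d ℓ hd hL b₀ b₁) (hG : G ≤ B7Prop2Explicit.unitaryUnits (Matrix (Fin N) (Fin N) ℂ))
    {U : CfgY (Matrix (Fin N) (Fin N) ℂ) i} (hU : ∀ μ x, U μ x ∈ G) :
    realify39 (basis39 (Matrix (Fin N) (Fin N) ℂ)) ((((unit39 i)⁻¹ : ℝ) : ℂ) • XinvY i (parSymY i) (GpY i (parSymY i)) U) *
        L39 i (parSymY i) (GpY i (parSymY i)) U = 1 ∧
      L39 i (parSymY i) (GpY i (parSymY i)) U *
        realify39 (basis39 (Matrix (Fin N) (Fin N) ℂ)) ((((unit39 i)⁻¹ : ℝ) : ℂ) • XinvY i (parSymY i) (GpY i (parSymY i)) U) = 1 := by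
  have hX := isUnit_XY_parSymY i hG hU
  have hu : (((unit39 i : ℝ) : ℂ)) ≠ 0 := by exact_mod_cast (unit39_pos i).ne'
  have h1 : ((((unit39 i)⁻¹ : ℝ) : ℂ) • XinvY i (parSymY i) (GpY i (parSymY i)) U) *
      ((((unit39 i) : ℝ) : ℂ) • XY i (parSymY i) (GpY i (parSymY i)) U) = 1 := by
    rw [smul_mul_smul_comm, XinvY, Ring.inverse_mul_cancel _ hX]
    push_cast
    rw [inv_mul_cancel₀ hu, one_smul]
  have h2 : ((((unit39 i) : ℝ) : ℂ) • XY i (parSymY i) (GpY i (parSymY i)) U) *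
      ((((unit39 i)⁻¹ : ℝ) : ℂ) • XinvY i (parSymY i) (GpY i (parSymY i)) U) = 1 := by
    rw [smul_mul_smul_comm, XinvY, Ring.mul_inverse_cancel _ hX]
    push_cast
    rw [mul_inv_cancel₀ hu, one_smul]
  refine ⟨?_, ?_⟩
  · show _ * realify39 _ _ = 1
    rw [← realify39_mul, h1, realify39_one]
  · show realify39 _ _ * _ = 1
    rw [← realify39_mul, h2, realify39_one]

end Inverse

/-! ## §3 The geometry: the ball `NearC_□(35S_j∕8 + 1)` of a cover cube lies in ONE cube of print's class; its (3.35) datum -/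

section Geometry

variable {d ℓ : ℕ} {hd : 1 ≤ d + 1} {hL : Odd (ℓ + 1) ∧ 1 < ℓ + 1} {b₀ b₁ : ℝ}

/-- THE WINDOW ARITHMETIC OF THE BALL (integers): for `S ≥ 16`, `ℓ ≥ 4` and `|t| ≤ 35S∕8 + 1`, the label `t + ℓS + (S−1)∕2` relative to the corner
`(β − ℓ)·S` lies in `[0, 2(ℓ+1)S)`. [cite: Balaban1985BackgroundPropagators, p.409 («□̃⁵ ⊂ one class cube»; bookkeeping)] -/
theorem nearC_window_arith {S t ℓz : ℤ} (hS : 16 ≤ S) (hℓ : 4 ≤ ℓz) (ht : |t| ≤ 35 * S / 8 + 1) :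
    0 ≤ t + ℓz * S + (S - 1) / 2 ∧ t + ℓz * S + (S - 1) / 2 < 2 * (ℓz + 1) * S := by
  have h := abs_le.1 ht
  have h4 : 4 * S ≤ ℓz * S := by nlinarith
  have h8 : 8 * (35 * S / 8) ≤ 35 * S := Int.mul_ediv_self_le (by norm_num)
  have h2 : 2 * ((S - 1) / 2) ≤ S - 1 := Int.mul_ediv_self_le (by norm_num)
  have h2' : S - 1 < 2 * ((S - 1) / 2) + 2 := Int.lt_mul_ediv_self_add (by norm_num)
  constructor
  · linarith
  · linarith

variable (i : KIdx d ℓ hd hL b₀ b₁)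

/-- `16 ≤ S_j = M_h·L^{j+1}` (`M_h ≥ 8`, `L ≥ 5`). [cite: Balaban1984PropagatorsII, (2.1) p.224, bookkeeping] -/
theorem sixteen_le_bigSide (j : ℕ) : 16 ≤ bigSide ℓ i.Mh j := by
  have h8 := i.hM8
  have hℓ := i.hℓ
  unfold B6MultiLevelBoxOperator.bigSide
  calc 16 ≤ 8 * (ℓ + 1) ^ 1 := by nlinarith
    _ ≤ i.Mh * (ℓ + 1) ^ (j + 1) := Nat.mul_le_mul h8 (Nat.pow_le_pow_right (Nat.succ_pos ℓ) (by omega))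

/-- ★★ **THE BALL `NearC_□(35S_j∕8 + 1)` OF A COVER CUBE LIES IN ONE CUBE OF PRINT's CLASS** (threshold `cthr ≤ 10`): the aligned cube of `2L` big `j`-blocks
cornered at `(β − ℓ)·S_j` — a P-triple of index `j` (size `2L`) or `j − 1` (size `2L²`) by (2.2) with `R ≥ 2L²` (g23 `alignedCube_mem_cubeClassP_or`) — contains
every torus site each of whose labels is within integer torus distance `35S_j∕8 + 1` of the centre of `β` (p33's radius for the cube letters' datum set `Q_□`;
inside print's □̃⁵).  This answers p33's question (Q1) («which class cube supplies `Q_□ ⊇ NearC_□(35S_j∕8 + 1)`») at def-Y's members.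
[cite: Balaban1985BackgroundPropagators, p.409 («the cube □̃⁵ is contained in one of the cubes for which this condition holds»), p.396 (the class, «≧ 10»); Balaban1984PropagatorsII, (2.2) p.224] -/
theorem exists_cubeClassP_nearC (c : ↥(cubes (toKT i).D.toDomains)) {cthr : ℝ} (hc : cthr ≤ 10) :
    ∃ q ∈ cubeClassP i cthr,
      ((q.2.1 = c.1.1 ∧ q.2.2 = 2 * (ℓ + 1)) ∨ (q.2.1 + 1 = c.1.1 ∧ q.2.2 = 2 * (ℓ + 1) * (ℓ + 1))) ∧
      ∀ w : Site (PV d ℓ i.m i.K hd hL) 0, NearC i c (35 * SC i c / 8 + 1) (boxEquiv i.hN w).1 → w ∈ q.1 := by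
  classical
  obtain ⟨S, hSdef⟩ : ∃ S : ℕ, S = bigSide ℓ i.Mh c.1.1 := ⟨_, rfl⟩
  have h8 : 8 ≤ i.Mh := i.hM8
  have hℓ : 4 ≤ ℓ := i.hℓ
  have hS : 0 < S := by rw [hSdef]; unfold B6MultiLevelBoxOperator.bigSide; positivity
  have hS16 : (16 : ℤ) ≤ (S : ℤ) := by rw [hSdef]; exact_mod_cast sixteen_le_bigSide i c.1.1
  -- the witness: a site of level `j` in the big block `β`
  obtain ⟨x₀, hx₀def⟩ : ∃ x₀ : Site (PV d ℓ i.m i.K hd hL) 0, x₀ = (boxEquiv i.hN).symm (wit i.D.toDomains c) := ⟨_, rfl⟩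
  have hx₀box : toBox i.hN x₀ = wit i.D.toDomains c := by
    have := (boxEquiv i.hN).apply_symm_apply (wit i.D.toDomains c)
    rw [hx₀def]; simpa only [boxEquiv_apply] using this
  have hx₀lev : levV1 i x₀ = c.1.1 := by
    show i.D.lev (toBox i.hN x₀).1 = c.1.1
    rw [hx₀box]
    exact lev_wit i.D.toDomains c
  have hjk : c.1.1 ≤ i.k := hx₀lev ▸ levV1_le i x₀
  have hj1 : 1 ≤ c.1.1 := hx₀lev ▸ levV1_pos i x₀
  have hsN : S ∣ (PV d ℓ i.m i.K hd hL).sitesPerDir 0 := by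
    have hNe : (PV d ℓ i.m i.K hd hL).sitesPerDir 0 = bigSide ℓ i.Mh i.k * i.P' 0 := by
      rw [← i.hN 0, B6MultiLevelTorusOperator.N0_eq_bigSide_mul]
    rw [hNe, hSdef]
    exact dvd_mul_of_dvd_left ⟨(ℓ + 1) ^ (i.k - c.1.1), bigSide_eq_mul_pow hjk⟩ _
  have hN1 : 1 ≤ (PV d ℓ i.m i.K hd hL).sitesPerDir 0 := Nat.one_le_iff_ne_zero.2 ((PV d ℓ i.m i.K hd hL).sitesPerDir_ne_zero 0)
  -- the corner `(β − ℓ)·S`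
  obtain ⟨c₀, hc₀def⟩ : ∃ c₀ : Site (PV d ℓ i.m i.K hd hL) 0,
      c₀ = fun μ => (((c.1.2 μ - ℓ) * (S : ℤ) : ℤ) : ZMod ((PV d ℓ i.m i.K hd hL).sitesPerDir 0)) := ⟨_, rfl⟩
  have hc₀ : ∀ μ, S ∣ (c₀ μ).val := by
    intro μ
    have hval : ((c₀ μ).val : ℤ) = ((c.1.2 μ - ℓ) * (S : ℤ)) % ((PV d ℓ i.m i.K hd hL).sitesPerDir 0 : ℤ) := by
      rw [hc₀def]; exact ZMod.val_intCast _
    have hdvd : (S : ℤ) ∣ ((c₀ μ).val : ℤ) := by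
      rw [hval, Int.emod_def]
      exact dvd_sub (dvd_mul_left _ _) (dvd_mul_of_dvd_left (Int.natCast_dvd_natCast.2 hsN) _)
    exact_mod_cast hdvd
  have hx₀Q : x₀ ∈ torusCube c₀ (2 * (ℓ + 1) * S) := by
    intro μ
    have hcoord : (wit i.D.toDomains c).1 μ / (S : ℤ) = c.1.2 μ := by
      have := congrFun (blk_wit i.D.toDomains c) μ
      rw [← hSdef] at this
      exact this
    have hS0 : (0 : ℤ) < (S : ℤ) := by exact_mod_cast hS
    have hlo : (S : ℤ) * c.1.2 μ ≤ (wit i.D.toDomains c).1 μ := by rw [← hcoord]; exact Int.mul_ediv_self_le (ne_of_gt hS0)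
    have hhi : (wit i.D.toDomains c).1 μ < (S : ℤ) * c.1.2 μ + S := by rw [← hcoord]; exact Int.lt_mul_ediv_self_add hS0
    have hval : ((x₀ μ).val : ℤ) = (wit i.D.toDomains c).1 μ := by rw [hx₀def]; exact val_boxEquiv_symm i.hN _ μ
    have e : c₀ μ = (((c.1.2 μ - ℓ) * (S : ℤ) : ℤ) : ZMod ((PV d ℓ i.m i.K hd hL).sitesPerDir 0)) := by rw [hc₀def]
    have hℓZ : (4 : ℤ) ≤ (ℓ : ℤ) := by exact_mod_cast hℓ
    rw [e]
    refine val_sub_intCast_lt_of_window i x₀ μ _ 0 ?_ ?_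
    · rw [hval, mul_zero, sub_zero]; nlinarith
    · rw [hval, mul_zero, sub_zero]; push_cast; nlinarith
  have hnR : 2 * (ℓ + 1) * (ℓ + 1) ≤ i.R := by have := i.hR2; nlinarith
  rw [hSdef] at hc₀ hx₀Q
  have hP := alignedCube_mem_cubeClassP_or i hc (by omega : 10 ≤ 2 * (ℓ + 1)) hnR hj1 hjk c₀ hc₀ hx₀Q hx₀lev
  -- the ball lies in the aligned cube
  have hball : ∀ w : Site (PV d ℓ i.m i.K hd hL) 0, NearC i c (35 * SC i c / 8 + 1) (boxEquiv i.hN w).1 →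
      w ∈ torusCube c₀ (2 * (ℓ + 1) * S) := by
    intro w hw μ
    have hwμ : circAbs ((PV d ℓ i.m i.K hd hL).sitesPerDir 0) (((w μ).val : ℤ) - ctrC c μ) ≤ 35 * (S : ℤ) / 8 + 1 := by
      have h := hw μ
      have hNB : (toKT i).NB μ = (PV d ℓ i.m i.K hd hL).sitesPerDir 0 := i.hN μ
      rw [hNB] at h
      rw [hSdef]
      exact h
    obtain ⟨m, hm⟩ := exists_abs_sub_le_of_circAbs_le hN1 hwμ
    have hctr : ctrC c μ = c.1.2 μ * (S : ℤ) + ((S : ℤ) - 1) / 2 := by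
      show c.1.2 μ * sI ℓ (toKT i).Mh c.1.1 + hf ℓ (toKT i).Mh c.1.1 = _
      unfold B9CubeSequence408.hf B9CubeSequence408.sI
      rw [hSdef]; rfl
    have hℓZ : (4 : ℤ) ≤ (ℓ : ℤ) := by exact_mod_cast hℓ
    have key := nearC_window_arith (t := ((w μ).val : ℤ) - ctrC c μ - ((PV d ℓ i.m i.K hd hL).sitesPerDir 0 : ℤ) * m) hS16 hℓZ hm
    have e : c₀ μ = (((c.1.2 μ - ℓ) * (S : ℤ) : ℤ) : ZMod ((PV d ℓ i.m i.K hd hL).sitesPerDir 0)) := by rw [hc₀def]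
    rw [e]
    refine val_sub_intCast_lt_of_window i w μ _ m ?_ ?_
    · have := key.1; rw [hctr] at this; linarith
    · have := key.2; rw [hctr] at this; push_cast; linarith
  rw [hSdef] at hball
  rcases hP with hP | hP
  · exact ⟨_, hP, Or.inl ⟨rfl, rfl⟩, hball⟩
  · exact ⟨_, hP, Or.inr ⟨by simp only; omega, rfl⟩, hball⟩

variable {𝔸 : Type} [NormedRing 𝔸] [NormedAlgebra ℂ 𝔸] [CompleteSpace 𝔸] {G : Subgroup 𝔸ˣ}

/-- ★★ **(3.35) ON THE BALL `NearC_□(35S_j∕8 + 1)` OF EVERY COVER CUBE, FROM PRINT's CLASS**: ONE gauge and ONE small field with `U^u = e^{iηA}`,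
`|A| < C·(Lʲη)⁻¹`, `|∇^ηA| < C·(Lʲη)⁻²`, `C = 2L⁴·(M·α₀)`, on every site of the ball, for `U ∈ (bg9KP 𝔸 G i).Reg335 cthr α₀` (`cthr ≤ 10`, `α₀ ≥ 0`) —
g23's `reg335Cube_of_wideCover_or` on the cube of `exists_cubeClassP_nearC`. [cite: Balaban1985BackgroundPropagators, (3.35) p.396, p.409] -/
theorem reg335Cube_nearC_of_reg335P (c : ↥(cubes (toKT i).D.toDomains)) {cthr α₀ : ℝ} (hc : cthr ≤ 10) (hα : 0 ≤ α₀)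
    {U : CfgV1 (PV d ℓ i.m i.K hd hL) 𝔸} (h : (bg9KP 𝔸 G i).Reg335 cthr α₀ U) :
    Reg335Cube (shiftsV1 (PV d ℓ i.m i.K hd hL)) U (kGeo i).eta {w | NearC i c (35 * SC i c / 8 + 1) (boxEquiv i.hN w).1}
      (scaleLen (kGeo i).L (kGeo i).eta c.1.1) (2 * (kGeo i).L ^ 4 * ((kGeo i).M * α₀)) := by
  obtain ⟨q, hqP, hcase, hball⟩ := exists_cubeClassP_nearC i c hc
  exact reg335Cube_of_wideCover_or i hα h hqP hcase fun w hw => hball w hw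

end Geometry

/-! ## §4 ★★★ Rows 15–16's display `Conv348Blk (oneCubeOps39YF …)` ON PRINT's CLASS at the letters of record, for every SECTION-CARRYING member -/

section Record

open scoped Matrix.Norms.L2Operator
open B7Prop2SpecialUnitary

variable {N : ℕ} (θ : Stage3Params) (Mstar : ℕ)
variable [∀ x : MemberY θ.d₆ θ.ℓ₆ θ.hd' θ.hL' θ.b₀ θ.b₁ Mstar, Fintype (geo9Y x).Site]

/-- ★★★ **(3.48)⁻¹ — ROWS 15–16's ONE DISPLAY — HOLDS ON PRINT's CLASS (3.35) AT def-Y's LETTERS OF RECORD, FOR EVERY SECTION-CARRYING MEMBER ABOVE ONE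
THRESHOLD**: there are `M₁, a₁, B₀, δ₀ > 0` (functions of `d, L, N` only) such that for every residual letter `𝔯`, every bond map `bI` with `β ∘ bI ∘ β = β`
(`hβI`, the knit's displayed fact), every member `x` of Stage 3′(Y) whose carrier-block map `β` is ONTO `𝔅` (no inner corner — n06-i
`B9BetaRangeKLevelV1.surjective_beta_iff`; every constant-level member qualifies) with `M₁ ≦ M`, every `α₀ > 0` with `c₃₅·M·α₀ ≦ a₁` and every `SU(N)`-valued `U`
in print's class `(bg9YP … x).Reg335 c₃₅ α₀`:  `Conv348Blk (oneCubeOps39YF θ M⋆ (lettersYOfRecordV4P N θ M⋆ 𝔯) bI x) B₀ δ₀ U` — the genuine `L39(U) = Q′G′²Q′*(U)` in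
print's units and real coordinates has a two-sided inverse with block majorant `B₀(Lʲη)⁻⁴e^{−δ₀d}` w.r.t. `blk39F … (bI x)`.  PROOF = lit-balaban's Theorem 3.2
`B9Thm32CinvAtMemberOfCubeDataThmD.cinv_at_member_of_cubeData_thmD` (Thms 3.7 + 3.9 + D at the member letter `parSymY`) fed §3's per-cube datum of the class
(p33 `exists_cubeData_of_reg335Cubes`), the section `ιB := rep39F (bI x)` (a section BECAUSE `β` is onto, `beta_rep39F_beta`), the basis `basis39` with its
coordinate bound (`abs_repr_le`), and read back through §1–§2 (`realify39 = conj`, `unit39 = η⁴`, `T·L39 = L39·T = 1`).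
[cite: Balaban1985BackgroundPropagators, Thm 3.2 (3.48) p.398 + (3.96) p.411 + Thm 3.9 p.413 + (3.35) p.396 + p.409; Balaban1984PropagatorsII, (2.51) p.232 + (2.86)–(2.87) p.238] -/
theorem conv348_oneCubeYF_of_regYP335_section (hN : 1 ≤ N) : ∃ M₁ a₁ B₀ δ₀ : ℝ, 0 < M₁ ∧ 0 < a₁ ∧ 0 < B₀ ∧ 0 < δ₀ ∧
    ∀ (𝔯 : ResY N θ Mstar) (bI : ∀ x : MemberY θ.d₆ θ.ℓ₆ θ.hd' θ.hL' θ.b₀ θ.b₁ Mstar, FBondY x.toKIdx → IBondY x.toKIdx)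
      (_hβI : ∀ (x : MemberY θ.d₆ θ.ℓ₆ θ.hd' θ.hL' θ.b₀ θ.b₁ Mstar) (f : FBondY x.toKIdx) (c : IBondY x.toKIdx),
        blkV1 x.hN x.D f = β x.hN x.D x.hk c → β x.hN x.D x.hk (bI x f) = blkV1 x.hN x.D f)
      (x : MemberY θ.d₆ θ.ℓ₆ θ.hd' θ.hL' θ.b₀ θ.b₁ Mstar), Function.Surjective (β x.hN x.D x.hk) → M₁ ≤ (geo9Y x).M →
      ∀ α₀ : ℝ, 0 < α₀ → c35Y * (geo9Y x).M * α₀ ≤ a₁ →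
      ∀ U : CfgY (Matrix (Fin N) (Fin N) ℂ) x.toKIdx,
        (bg9YP (Matrix (Fin N) (Fin N) ℂ) (specialUnitaryUnits (Fin N)) x).Reg335 c35Y α₀ U →
        Conv348Blk (oneCubeOps39YF θ Mstar (lettersYOfRecordV4P N θ Mstar 𝔯) bI x) B₀ δ₀ U := by
  classical
  haveI : Nonempty (Fin N) := ⟨⟨0, hN⟩⟩
  haveI instK : ∀ i' : KIdx θ.d₆ θ.ℓ₆ θ.hd' θ.hL' θ.b₀ θ.b₁, Fintype (geo9K i').Site := fun i' => (kGeoU i').fin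
  haveI instD : ∀ i' : KIdx θ.d₆ θ.ℓ₆ θ.hd' θ.hL' θ.b₀ θ.b₁, DecidableEq (geo9K i').Site := fun i' => Classical.decEq _
  have hG : specialUnitaryUnits (Fin N) ≤ B7Prop2Explicit.unitaryUnits (Matrix (Fin N) (Fin N) ℂ) := specialUnitaryUnits_le_unitaryUnits
  have hM₂ : 0 ≤ coordBound39 (basis39 (Matrix (Fin N) (Fin N) ℂ)) := norm_nonneg _
  obtain ⟨δ, K, M₀, T₀, N₀, hδ, hK, a₁, ha₁, H⟩ :=
    cinv_at_member_of_cubeData_thmD (d := θ.d₆) (ℓ := θ.ℓ₆) (hd := θ.hd') (hL := θ.hL') (b₀ := θ.b₀) (b₁ := θ.b₁)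
      (G := specialUnitaryUnits (Fin N)) (basis39 (Matrix (Fin N) (Fin N) ℂ)) hG
      (fun _ => (0 : ℝ)) (fun _ => True) θ.one_le_ℓ₆ hM₂ (fun v j => abs_repr_le (basis39 (Matrix (Fin N) (Fin N) ℂ)) v j)
  -- the constants: `L`, the (3.37) budget, the threshold
  set L : ℝ := ((θ.ℓ₆ : ℝ) + 1) with hLdef
  have hL1 : 1 ≤ L := by rw [hLdef]; have : (0:ℝ) ≤ θ.ℓ₆ := Nat.cast_nonneg _; linarith
  have hL0 : 0 < L := lt_of_lt_of_le one_pos hL1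
  have hD1 : 0 ≤ D1 thetaProf := D1_nonneg contDiff_thetaProf hasCompactSupport_thetaProf
  set amin : ℝ := min a₁ (1 / 4) with hamin
  have hamin0 : 0 < amin := lt_min ha₁ (by norm_num)
  refine ⟨max (max M₀ ((N₀ : ℝ) + 1)) (max (T₀ + 1) 1), c35Y * amin / (2 * L ^ 6 * (1 + D1 thetaProf)), K + 1, δ,
    lt_of_lt_of_le one_pos ((le_max_right _ _).trans (le_max_right _ _)), ?_, by linarith, hδ, ?_⟩
  · have hc : (0 : ℝ) < c35Y := by norm_num [c35Y]
    positivity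
  intro 𝔯 bI hβI x hsurj hM α₀ hα ha U hU
  -- the member's index facts
  have hMeq : (geo9Y x).M = L * x.Mh := by rw [B9Ineq349SiteFromBlocks.geo9Y_M_eq]
  have hM0 : M₀ ≤ ((θ.ℓ₆ : ℝ) + 1) * (toKT x.toKIdx).Mh := by
    have : M₀ ≤ (geo9Y x).M := ((le_max_left _ _).trans (le_max_left _ _)).trans hM
    rw [hMeq] at this; exact this
  have hMh1 : 1 ≤ (θ.ℓ₆ + 1) * x.Mh := Nat.one_le_iff_ne_zero.2 (Nat.mul_ne_zero (Nat.succ_ne_zero _) (by have := x.hM8; omega))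
  have hR1 : 1 ≤ x.R := le_trans (by have := θ.one_le_ℓ₆; nlinarith) x.hR2
  have hN0 : N₀ + 1 ≤ (toKT x.toKIdx).R * ((θ.ℓ₆ + 1) * (toKT x.toKIdx).Mh) := by
    show N₀ + 1 ≤ x.R * ((θ.ℓ₆ + 1) * x.Mh)
    have h1 : ((N₀ : ℝ) + 1) ≤ L * x.Mh := by rw [← hMeq]; exact ((le_max_right _ _).trans (le_max_left _ _)).trans hM
    have h2 : N₀ + 1 ≤ (θ.ℓ₆ + 1) * x.Mh := by rw [hLdef] at h1; exact_mod_cast h1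
    exact h2.trans (Nat.le_mul_of_pos_left _ hR1)
  have hT0 : T₀ ≤ B9CubeGeometryInputs.RM1 x.toKIdx := by
    unfold B9CubeGeometryInputs.RM1
    show T₀ ≤ (((x.R * ((θ.ℓ₆ + 1) * x.Mh) - 1 : ℕ)) : ℝ)
    have h1 : T₀ + 1 ≤ L * x.Mh := by rw [← hMeq]; exact ((le_max_left _ _).trans (le_max_right _ _)).trans hM
    have h3 : (θ.ℓ₆ + 1) * x.Mh ≤ x.R * ((θ.ℓ₆ + 1) * x.Mh) := Nat.le_mul_of_pos_left _ hR1
    have h4 : (((θ.ℓ₆ + 1) * x.Mh : ℕ) : ℝ) ≤ ((x.R * ((θ.ℓ₆ + 1) * x.Mh) : ℕ) : ℝ) := by exact_mod_cast h3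
    rw [Nat.cast_sub (hMh1.trans h3)]
    push_cast at h4 ⊢
    rw [hLdef] at h1
    linarith
  -- the class: `U` is `SU(N)`-valued; the per-cube datum on the balls
  have hUG : ∀ μ z, U μ z ∈ specialUnitaryUnits (Fin N) := hU.1.1
  have hdat : ∀ c : ↥(cubes (toKT x.toKIdx).D.toDomains),
      Reg335Cube (shiftsV1 (PV θ.d₆ θ.ℓ₆ x.m x.K θ.hd' θ.hL')) U (kGeo x.toKIdx).eta
        {w | NearC x.toKIdx c (35 * SC x.toKIdx c / 8 + 1) (boxEquiv x.hN w).1}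
        (scaleLen (kGeo x.toKIdx).L (kGeo x.toKIdx).eta c.1.1) (2 * (kGeo x.toKIdx).L ^ 4 * ((kGeo x.toKIdx).M * α₀)) :=
    fun c => reg335Cube_nearC_of_reg335P x.toKIdx c (by norm_num [c35Y]) hα.le hU.1
  obtain ⟨g, A, hu, hgA, hA, hdA⟩ := B9Cor36GpCoverBindersUnitary.exists_cubeData_of_reg335Cubes x.toKIdx U _ _ _ hdat
  -- the section through the faithful representative (β onto)
  have hι : ∀ s : BlkY x.toKIdx, β x.hN x.D x.hk (rep39F x.toKIdx (bI x) s) = s := by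
    intro s
    obtain ⟨c, rfl⟩ := hsurj s
    exact beta_rep39F_beta (hβI x) c
  -- the geometric side conditions of the data
  obtain ⟨hη, hLK1, hMK⟩ := eta_pos_L_one_le_M_pos x.toKIdx
  have hLK : (kGeo x.toKIdx).L = L := by rw [hLdef]; show (((θ.ℓ₆ + 1 : ℕ) : ℝ)) = _; push_cast; ring
  have hMK' : (kGeo x.toKIdx).M = (geo9Y x).M := rfl
  have hC0 : 0 ≤ 2 * (kGeo x.toKIdx).L ^ 4 * ((kGeo x.toKIdx).M * α₀) := by positivity
  have hξ0 : ∀ c : ↥(cubes (toKT x.toKIdx).D.toDomains), 0 < scaleLen (kGeo x.toKIdx).L (kGeo x.toKIdx).eta c.1.1 :=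
    fun c => LatticeNorms.scaleLen_pos (lt_of_lt_of_le one_pos hLK1) hη _
  have hξ5 : ∀ c : ↥(cubes (toKT x.toKIdx).D.toDomains),
      scaleLen (kGeo x.toKIdx).L (kGeo x.toKIdx).eta c.1.1 ≤ 5 * (SC x.toKIdx c : ℝ) * (kGeo x.toKIdx).eta := by
    intro c
    unfold LatticeNorms.scaleLen
    have hS : (kGeo x.toKIdx).L ^ c.1.1 ≤ (SC x.toKIdx c : ℝ) := by
      rw [hLK, hLdef]
      show ((θ.ℓ₆ : ℝ) + 1) ^ c.1.1 ≤ ((sI θ.ℓ₆ (toKT x.toKIdx).Mh c.1.1 : ℤ) : ℝ)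
      unfold B9CubeSequence408.sI B6MultiLevelBoxOperator.bigSide
      have h8 : 8 ≤ x.Mh := x.hM8
      have h1 : (θ.ℓ₆ + 1) ^ c.1.1 ≤ x.Mh * (θ.ℓ₆ + 1) ^ (c.1.1 + 1) :=
        le_trans (le_trans (Nat.pow_le_pow_right (Nat.succ_pos _) (Nat.le_succ _)) (Nat.le_mul_of_pos_left _ (by omega))) le_rfl
      have h2 : (((θ.ℓ₆ + 1) ^ c.1.1 : ℕ) : ℝ) ≤ ((x.Mh * (θ.ℓ₆ + 1) ^ (c.1.1 + 1) : ℕ) : ℝ) := by exact_mod_cast h1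
      push_cast at h2 ⊢
      exact h2
    have hSC0 : 0 ≤ (SC x.toKIdx c : ℝ) := le_trans (pow_pos (lt_of_lt_of_le one_pos hLK1) _).le hS
    calc (kGeo x.toKIdx).L ^ c.1.1 * (kGeo x.toKIdx).eta ≤ (SC x.toKIdx c : ℝ) * (kGeo x.toKIdx).eta :=
          mul_le_mul_of_nonneg_right hS hη.le
      _ ≤ 5 * (SC x.toKIdx c : ℝ) * (kGeo x.toKIdx).eta := by nlinarith
  have hscale : ∀ c : ↥(cubes (toKT x.toKIdx).D.toDomains),
      scaleLen ((θ.ℓ₆ : ℝ) + 1) (kGeo x.toKIdx).eta (c.1.1 + 1) ≤ (kGeo x.toKIdx).L * scaleLen (kGeo x.toKIdx).L (kGeo x.toKIdx).eta c.1.1 := by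
    intro c; rw [hLK, hLdef, B9Eq335ClassBridgePV1.scaleLen_succ']
  have hsmall : 2 * L ^ 6 * (1 + D1 thetaProf) * ((geo9Y x).M * α₀) ≤ amin := by
    have hc : (0 : ℝ) < c35Y := by norm_num [c35Y]
    have hpos : 0 < 2 * L ^ 6 * (1 + D1 thetaProf) := by positivity
    have h1 : (geo9Y x).M * α₀ ≤ amin / (2 * L ^ 6 * (1 + D1 thetaProf)) := by
      have : c35Y * ((geo9Y x).M * α₀) ≤ c35Y * (amin / (2 * L ^ 6 * (1 + D1 thetaProf))) := by
        rw [mul_div_assoc] at ha; linarith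
      exact le_of_mul_le_mul_left this hc
    calc 2 * L ^ 6 * (1 + D1 thetaProf) * ((geo9Y x).M * α₀)
        ≤ 2 * L ^ 6 * (1 + D1 thetaProf) * (amin / (2 * L ^ 6 * (1 + D1 thetaProf))) := mul_le_mul_of_nonneg_left h1 hpos.le
      _ = amin := mul_div_cancel₀ _ hpos.ne'
  have hmaxeq : max (2 * (kGeo x.toKIdx).L ^ 4 * ((kGeo x.toKIdx).M * α₀)) (2 * (kGeo x.toKIdx).L ^ 4 * ((kGeo x.toKIdx).M * α₀) * (1 + D1 thetaProf))
      * (kGeo x.toKIdx).L ^ 2 = 2 * L ^ 6 * (1 + D1 thetaProf) * ((geo9Y x).M * α₀) := by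
    rw [max_eq_right (le_mul_of_one_le_right hC0 (by linarith)), hLK, hMK']; ring
  -- lit-balaban's Theorem 3.2 at the member, fed the data
  have hmaj := H x.toKIdx hM0 hN0 hT0 x.hcfk (rep39F x.toKIdx (bI x)) hι U hUG g hu A
    (fun c => {w | NearC x.toKIdx c (35 * SC x.toKIdx c / 8 + 1) (boxEquiv x.hN w).1})
    (fun _ => 2 * (kGeo x.toKIdx).L ^ 4 * ((kGeo x.toKIdx).M * α₀)) (fun c => scaleLen (kGeo x.toKIdx).L (kGeo x.toKIdx).eta c.1.1)
    (fun _ => (kGeo x.toKIdx).L) (fun _ => hC0) hξ0 (fun _ => hLK1) hξ5 hscale (fun c w hw => hw) hgA hA hdA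
    (fun _ => by rw [hmaxeq]; exact hsmall.trans (min_le_left _ _)) (fun _ => by rw [hmaxeq]; exact hsmall.trans (min_le_right _ _))
    (B := bg9YP (Matrix (Fin N) (Fin N) ℂ) (specialUnitaryUnits (Fin N)) x) (fun V => V) U rfl
  -- read back through the dictionary
  set T : Module.End ℝ (X39 (Matrix (Fin N) (Fin N) ℂ) x.toKIdx → ℝ) :=
    realify39 (basis39 (Matrix (Fin N) (Fin N) ℂ))
      ((((unit39 x.toKIdx)⁻¹ : ℝ) : ℂ) • XinvY x.toKIdx (parSymY x.toKIdx) (GpY x.toKIdx (parSymY x.toKIdx)) U) with hTdef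
  have hT : T = conj (basis39 (Matrix (Fin N) (Fin N) ℂ))
      ((etaS x.toKIdx ^ 2 * etaS x.toKIdx ^ 2)⁻¹ • (XinvY x.toKIdx (parSymY x.toKIdx) (GpY x.toKIdx (parSymY x.toKIdx)) U).restrictScalars ℝ) := by
    rw [hTdef, realify39_real_smul_eq_conj, unit39_eq_etaS_sq_mul]
  rw [← hT] at hmaj
  have hmaj' : HasMajorant (g := b6 (geo9Y x)) (blk39F (Matrix (Fin N) (Fin N) ℂ) x.toKIdx (bI x)) T
      (fun a a' => K * ((geo9K x.toKIdx).len a ^ 4)⁻¹ * Real.exp (-(δ * (geo9K x.toKIdx).dist a a'))) := by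
    intro y' μ B hμ p
    exact hmaj y' μ B ⟨hμ.nonneg, hμ.bound, hμ.off⟩ p
  have hinv := invL39_two_sided_of_mem x.toKIdx hG hUG
  refine ⟨T, hinv.1, hinv.2, hasMajorant_mono _ hmaj' fun a a' => ?_⟩
  have hlen : 0 < (geo9Y x).len a := geo9Y_len_pos x a
  have hl4 : ((geo9K x.toKIdx).len a ^ 4)⁻¹ = (geo9Y x).len a ^ (-(4 : ℝ)) := by
    rw [Real.rpow_neg hlen.le, show ((4 : ℝ)) = ((4 : ℕ) : ℝ) by norm_num, Real.rpow_natCast]; rfl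
  rw [hl4]
  have h0 : 0 ≤ (geo9Y x).len a ^ (-(4 : ℝ)) * Real.exp (-(δ * (geo9Y x).dist a a')) :=
    mul_nonneg (Real.rpow_nonneg hlen.le _) (Real.exp_pos _).le
  show K * (geo9Y x).len a ^ (-(4 : ℝ)) * Real.exp (-(δ * (geo9Y x).dist a a')) ≤ (K + 1) * (geo9Y x).len a ^ (-(4 : ℝ)) * Real.exp (-(δ * (geo9Y x).dist a a'))
  nlinarith [h0]

/-- ★★★ **THE SAME AT THE N06 CERTIFICATE's R-GENERIC PREMISE** (rows 15–16's display `h348` of `Thm/BalabanUVNodesN06AtOpsYNuOfRecordV6EPairUB` VERBATIM in its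
body, premised on `(bg9YR … R₁ R₂ x).Reg335 c α₀ U` with the knit's class transfer `hRP1` and its guard `c·M·α₀ ≤ a₁`, `0 < c`): for every regularity-family pair
`(R₁, R₂)` whose first family lands in print's class (`hRP1`, the certificate's own displayed transfer), there are `M₁, a₁, B₀, δ₀ > 0` with
`Conv348Blk (oneCubeOps39YF θ M⋆ (lettersYOfRecordV4P N θ M⋆ 𝔯) bI x) B₀ δ₀ U` for every section-carrying member above `M₁`, every `α₀ > 0` with `c·M·α₀ ≦ a₁`
and every `U` of the R-class.  (At inner-corner members — `β` not onto — the display stays displayed: lit-balaban's member packages carry the SECTION binder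
`hι : ∀ s, β (ιB s) = s`.) [cite: Balaban1985BackgroundPropagators, Thm 3.2 (3.48) p.398 + (3.96) p.411 + (3.35) p.396] -/
theorem conv348_oneCubeYF_of_regYR_section (hN : 1 ≤ N)
    {R₁ R₂ : B9BackgroundsKLevelV1R.RegFamY θ.d₆ θ.ℓ₆ θ.hd' θ.hL' θ.b₀ θ.b₁ Mstar (Matrix (Fin N) (Fin N) ℂ)} {c : ℝ} (hc : 0 < c)
    (hRP1 : ∀ (x : MemberY θ.d₆ θ.ℓ₆ θ.hd' θ.hL' θ.b₀ θ.b₁ Mstar) (α₀ : ℝ)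
      (U : (B9BackgroundsKLevelV1R.bg9YR (Matrix (Fin N) (Fin N) ℂ) (specialUnitaryUnits (Fin N)) R₁ R₂ x).Cfg),
      (B9BackgroundsKLevelV1R.bg9YR (Matrix (Fin N) (Fin N) ℂ) (specialUnitaryUnits (Fin N)) R₁ R₂ x).Reg335 c α₀ U →
        0 ≤ α₀ ∧ (bg9YP (Matrix (Fin N) (Fin N) ℂ) (specialUnitaryUnits (Fin N)) x).Reg335 c35Y α₀ U) :
    ∃ M₁ a₁ B₀ δ₀ : ℝ, 0 < M₁ ∧ 0 < a₁ ∧ 0 < B₀ ∧ 0 < δ₀ ∧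
    ∀ (𝔯 : ResY N θ Mstar) (bI : ∀ x : MemberY θ.d₆ θ.ℓ₆ θ.hd' θ.hL' θ.b₀ θ.b₁ Mstar, FBondY x.toKIdx → IBondY x.toKIdx)
      (_hβI : ∀ (x : MemberY θ.d₆ θ.ℓ₆ θ.hd' θ.hL' θ.b₀ θ.b₁ Mstar) (f : FBondY x.toKIdx) (c : IBondY x.toKIdx),
        blkV1 x.hN x.D f = β x.hN x.D x.hk c → β x.hN x.D x.hk (bI x f) = blkV1 x.hN x.D f)
      (x : MemberY θ.d₆ θ.ℓ₆ θ.hd' θ.hL' θ.b₀ θ.b₁ Mstar), Function.Surjective (β x.hN x.D x.hk) → M₁ ≤ (geo9Y x).M →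
      ∀ α₀ : ℝ, 0 < α₀ → c * (geo9Y x).M * α₀ ≤ a₁ →
      ∀ U : (B9BackgroundsKLevelV1R.bg9YR (Matrix (Fin N) (Fin N) ℂ) (specialUnitaryUnits (Fin N)) R₁ R₂ x).Cfg,
        (B9BackgroundsKLevelV1R.bg9YR (Matrix (Fin N) (Fin N) ℂ) (specialUnitaryUnits (Fin N)) R₁ R₂ x).Reg335 c α₀ U →
        Conv348Blk (oneCubeOps39YF θ Mstar (lettersYOfRecordV4P N θ Mstar 𝔯) bI x) B₀ δ₀ U := by
  obtain ⟨M₁, a₁, B₀, δ₀, hM₁, ha₁, hB₀, hδ₀, h⟩ := conv348_oneCubeYF_of_regYP335_section (N := N) θ Mstar hN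
  have hc35 : (0 : ℝ) < c35Y := by norm_num [c35Y]
  refine ⟨M₁, a₁ * (c / c35Y), B₀, δ₀, hM₁, by positivity, hB₀, hδ₀, fun 𝔯 bI hβI x hsurj hM α₀ hα ha U hU => ?_⟩
  refine h 𝔯 bI hβI x hsurj hM α₀ hα ?_ U (hRP1 x α₀ U hU).2
  have hMα : 0 ≤ (geo9Y x).M * α₀ := mul_nonneg (geo9Y_M_nonneg θ Mstar x) hα.le
  have h1 : c * ((geo9Y x).M * α₀) ≤ a₁ * (c / c35Y) := by rw [← mul_assoc]; exact ha
  have h2 : c35Y * ((geo9Y x).M * α₀) * c ≤ a₁ * c := by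
    have := mul_le_mul_of_nonneg_left h1 hc35.le
    calc c35Y * ((geo9Y x).M * α₀) * c = c35Y * (c * ((geo9Y x).M * α₀)) := by ring
      _ ≤ c35Y * (a₁ * (c / c35Y)) := this
      _ = a₁ * c := by field_simp
  rw [← mul_assoc] at h2
  exact le_of_mul_le_mul_right h2 hc

end Record

end Literature.MathematicalPhysics.QuantumFieldTheory.Balaban1983to89.B9Conv348OfRegYP335AtLettersY

end
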